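import Summits.HodgeConjecture.HodgeConjecture.Theorems.K2E5QuatLocalFrameAlgebra              -- ★ C1a (p16): `antidiagTwo`, `antidiagonal_over_eq_antidiagTwo`, `diagFrame`, `coe_diagFrame(_inv)`; brings ★ parts A∕B (`ev`, `localForm_map_ev`, `matrix_eq_iff_forall_map_ev`, `nnnorm_eq_normAbs`), ★ #3l `localAbs`
import Literature.NumberTheory.Automorphic.UnitaryGroupInertPlaceHyperbolicBasisDyadic       -- ★ `exists_glInt_placeForm_eq_formCongr_antidiagonal_of_isUnramifiedIn` [Jacobowitz1962, §7 Thm. 7.1]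
import Literature.NumberTheory.Automorphic.NonsplitPlaceHaarBallRatios                      -- brings ★ `valued_toPlace_of_isUnramifiedIn`, ★ `absNorm_placesOver_eq_sq_of_nonsplit_of_isUnramifiedIn`, ★ `finite_setOf_not_isUnramifiedIn`, ★ `normAbs_eq_inv_zpow_of_valued_eq`
import Literature.NumberTheory.Automorphic.LocalUnitaryIntegralLevel                        -- ★ `eventually_forall_unit_placeForm_mem_glInt`, ★ `eventually_forall_map_mem_glInt`
import HarnessLib

/-!
# G9b step (ii), part C2: FRAME SUPPLY at the non-split unramified good places, the skew unit `δ`, and the scalar modulus identity `|t ⊗ 1|_{E_v} = |t|_v²`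

Sub-problem `HodgeConjecture/HodgeConjecture`, crux H413 (`stmt-HodgeConjecture-24833`), organ K2E5 (Tamagawa `τ(D^×)`∕Siegel–Weil), deal G9b of K2E5-plan, step (ii).
This file discharges, for all but finitely many places `v` of `L⁺` NON-SPLIT in the CM field `L`, the hypotheses of ★ C1b `exists_splittingDatum_of_frame`
(`Theorems/K2E5QuatLocalSplittingOfFrame.lean`): an INTEGRAL HYPERBOLIC FRAME `T ∈ GL₂(𝒪_{E_v})` of `h_v` (`(T^σ)ᵀ Φ₂ T = H_v`), a SKEW UNIT `δ ∈ 𝒪_{E_v}^×` (`σδ = −δ`), and the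
scalar identity `hmodK`.

* §1 `exists_integralFrame_of_nonsplit` — at a non-split place `v` (`w ∣ v`, `c w = w`) unramified in `L` with `H_w ∈ GL₂(𝒪_w)`, the one-place integral hyperbolic basis of ★
  `exists_glInt_placeForm_eq_formCongr_antidiagonal_of_isUnramifiedIn` ([Jacobowitz1962, §7 Thm. 7.1]: unimodular hermitian lattices over an unramified quadratic extension are
  hyperbolic) transported along `E_v = L_w` (`RingEquiv.piUnique`, as in ★ `exists_formCongr_conjLocal_eq_smul_antidiag_three`).
* §2 `eventually_exists_skewUnit` — a global `δ ∈ L` with `c δ = −δ ≠ 0` (★ `exists_complexConj_eq_neg_ne_zero`) is a `v`-adic unit for almost all `v` (★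
  `eventually_forall_map_mem_glInt` on `diag(1,δ) ∈ GL₂(L)`).
* §3 `localAbs_toLocalRing_of_nonsplit` — `Π_{w∣v} ‖t ⊗ 1‖_w = normAbs_{K_v}(t)²` at a non-split unramified `v` (`e(w∣v) = 1`, ★ `valued_toPlace_of_isUnramifiedIn`; `N𝔓_w = N𝔭_v²`, ★
  `absNorm_placesOver_eq_sq_of_nonsplit_of_isUnramifiedIn`; both norms are `q^{−ord}`, ★ `normAbs_eq_inv_zpow_of_valued_eq`).
* §4 `eventually_frameData_of_nonsplit` — the three supplies packaged `∀ᶠ v in cofinite, ∀ w ∣ v, c w = w → …` (★ `finite_setOf_not_isUnramifiedIn`, ★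
  `eventually_forall_unit_placeForm_mem_glInt`).

Sources: [Jacobowitz1962] R. Jacobowitz, *Hermitian forms over local fields*, Amer. J. Math. 84 (1962), §7 Thm. 7.1; [PlatonovRapinchuk1994] §3.3, §5.1; [VignerasLNM800] Ch. II §1–2;
[NeukirchANT1999] Ch. II §6, §8 (`e f = 2` at a non-split place).  THEOREMS ONLY (no `def`, no instance, no notation, no named fact, no `sorry`).  HONEST LABEL: HC_CM is proved only
modulo the 7 printed citations (2 remaining named inputs: hLiu418 = stmt-HodgeConjecture-24832, h413 = stmt-HodgeConjecture-24833) until rung 0 closes; count-neutral helper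
(`--supports stmt-HodgeConjecture-24833`).
-/

set_option autoImplicit false
set_option linter.dupNamespace false

noncomputable section

open NumberField IsDedekindDomain
open Literature.NumberTheory.Automorphic Literature.NumberTheory.Automorphic.UnitaryGroup Literature.NumberTheory.Weil1982.UnitaryFinTopForm
open Literature.NumberTheory.GaloisRepresentations Literature.NumberTheory.GaloisRepresentations.IsNonarchimedeanLocalField
open Summit.HodgeConjecture.HodgeConjecture.Cruxes.H413.K2E5QuatAdelicMatrixModel Summit.HodgeConjecture.HodgeConjecture.Cruxes.H413.K2E5QuatLocalMeasure
open Summit.HodgeConjecture.HodgeConjecture.Cruxes.H413.K2E5QuatLocalZeta Summit.HodgeConjecture.HodgeConjecture.Cruxes.H413.K2E5QuatLocalSplittingAtSplit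
open Summit.HodgeConjecture.HodgeConjecture.Cruxes.H413.K2E5QuatLocalSplittingOfFrame
open scoped MatrixGroups NNReal Matrix ValuativeRel

namespace Summit.HodgeConjecture.HodgeConjecture.Cruxes.H413.K2E5QuatLocalFrameSupply

variable (L : Type) [Field L] [NumberField L] [IsCMField L] (Ha : Matrix (Fin 2) (Fin 2) L) (v : HeightOneSpectrum (𝓞 ↥(maximalRealSubfield L)))

/-! ## §1 The integral hyperbolic frame at a non-split unramified good place, in the `E_v` currency -/

omit [IsCMField L] in
/-- `Φ₂ ⊗ 1` has `w`-component `Φ₂`. [folklore] -/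
theorem antidiagTwo_map_ev (w : PlacesOver L v) : (antidiagTwo (LocalRing L v)).map (ev L v w) = antidiagTwo (w.1.adicCompletion L) := by
  ext i j
  fin_cases i <;> fin_cases j <;> simp [antidiagTwo]

/-- **Integral hyperbolic frame of `h_v` at a non-split unramified good place.**  For `h` hermitian with `det h ≠ 0`, `w ∣ v` with `c w = w`, `v` unramified in `L` and
`H_w ∈ GL₂(𝒪_w)`: there is `T ∈ GL₂(E_v)` with `T, T⁻¹ ∈ M₂(𝒪_{E_v})` and `(T^σ)ᵀ · Φ₂ · T = H_v` (★ Jacobowitz frame at `w`, transported along `E_v = L_w`).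
[cite: Jacobowitz1962, §7 Thm. 7.1] [cite: PlatonovRapinchuk1994, §5.1] -/
theorem exists_integralFrame_of_nonsplit (hHa : (Ha.map (cmConjRingHom L)).transpose = Ha) (hdet : Ha.det ≠ 0) (w : PlacesOver L v)
    (hw : IsCMField.complexConj L • w.1 = w.1) (hunr : Algebra.IsUnramifiedIn (𝓞 L) v.asIdeal)
    (hHi : (isUnit_placeForm Ha ((Matrix.isUnit_iff_isUnit_det Ha).2 (Ne.isUnit hdet)) w.1).unit ∈ glInt 2 (w.1.adicCompletion L)) :
    ∃ T : GL (Fin 2) (LocalRing L v), T.val ∈ intMatrices L 2 v ∧ T⁻¹.val ∈ intMatrices L 2 v ∧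
      ((T.val).map (conjLocal L (IsCMField.complexConj L) v))ᵀ * antidiagTwo (LocalRing L v) * T.val = localForm L 2 Ha v := by
  haveI : Algebra.IsQuadraticExtension ↥(maximalRealSubfield L) L := IsCMField.isQuadraticExtension L
  obtain ⟨Tw, hTwi, hTw⟩ := exists_glInt_placeForm_eq_formCongr_antidiagonal_of_isUnramifiedIn ↥(maximalRealSubfield L) L (IsCMField.complexConj L)
    (IsCMField.complexConj_ne_one L) 2 Ha ((map_cmConjRingHom_eq_map_complexConj L Ha) ▸ hHa) v w hw hunr _ hHi
  haveI : Subsingleton (PlacesOver L v) := PlacesOver.subsingleton_of_smul_eq (IsCMField.complexConj L) (IsCMField.complexConj_ne_one L) w hw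
  letI : Unique (PlacesOver L v) := uniqueOfSubsingleton w
  let π : LocalRing L v ≃+* w.1.adicCompletion L := RingEquiv.piUnique fun w' : PlacesOver L v => w'.1.adicCompletion L
  have hπs : ∀ y : w.1.adicCompletion L, (π.symm y) w = y := fun y => π.apply_symm_apply y
  let e : Matrix (Fin 2) (Fin 2) (w.1.adicCompletion L) ≃* Matrix (Fin 2) (Fin 2) (LocalRing L v) := π.symm.mapMatrix.toMulEquiv
  have hTe : ∀ S : GL (Fin 2) (w.1.adicCompletion L), ((Units.mapEquiv e S).val).map (ev L v w) = S.val := fun S =>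
    Matrix.ext fun i j => hπs (S.val i j)
  -- integrality of a transported matrix is read off at `w`
  have hint : ∀ S : GL (Fin 2) (w.1.adicCompletion L), IsIntegralMatrix S.val → (Units.mapEquiv e S).val ∈ intMatrices L 2 v := by
    intro S hS
    rw [Literature.NumberTheory.Weil1982.UnitaryFinTopForm.mem_intMatrices_iff]
    intro i j
    rw [mem_localIntegers_iff]
    intro w'
    obtain rfl : w' = w := Subsingleton.elim w' w
    have h := hS i j
    rwa [← hTe S] at h
  refine ⟨Units.mapEquiv e Tw, hint Tw (isIntegralMatrix_of_mem_glInt hTwi), ?_, ?_⟩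
  · rw [← map_inv]
    exact hint Tw⁻¹ (isIntegralMatrix_inv_of_mem_glInt hTwi)
  · -- the frame identity, checked at the unique place `w`
    rw [matrix_eq_iff_forall_map_ev L v]
    intro w'
    obtain rfl : w = w' := Subsingleton.elim w w'
    have hconj : ((Units.mapEquiv e Tw).val.map (conjLocal L (IsCMField.complexConj L) v)).map (ev L v w) =
        (Tw.val).map (galAdicCompletionMap (L := L) (IsCMField.complexConj L) hw) := by
      refine Matrix.ext fun i j => ?_
      simp only [Matrix.map_apply, Pi.evalRingHom_apply]
      rw [conjLocal_apply_eq_of_smul_eq (IsCMField.complexConj L) (IsCMField.complexConj_ne_one L) v w hw]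
      exact congrArg _ (hπs (Tw.val i j))
    rw [Matrix.map_mul, Matrix.map_mul, Matrix.transpose_map, hconj, antidiagTwo_map_ev, hTe, localForm_map_ev, hTw, formCongr,
      antidiagonal_over_eq_antidiagTwo]

/-! ## §2 The skew unit `δ` -/

/-- **A skew `v`-adic unit for almost every `v`**: there is `δ ∈ L` with `c δ = −δ ≠ 0`, and for all but finitely many `v` the element `δ ⊗ 1 ∈ E_v` and its inverse are integral.
[cite: PlatonovRapinchuk1994, §5.1] -/
theorem eventually_exists_skewUnit :
    ∀ᶠ v : HeightOneSpectrum (𝓞 ↥(maximalRealSubfield L)) in Filter.cofinite, ∃ δ : (LocalRing L v)ˣ,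
      conjLocal L (IsCMField.complexConj L) v δ = -δ ∧ (δ : LocalRing L v) ∈ localIntegers L v ∧ ((δ⁻¹ : (LocalRing L v)ˣ) : LocalRing L v) ∈ localIntegers L v := by
  obtain ⟨δ, hδc, hδ0⟩ := exists_complexConj_eq_neg_ne_zero L
  filter_upwards [eventually_forall_map_mem_glInt ↥(maximalRealSubfield L) L (diagFrame (Units.mk0 δ hδ0))] with v hv
  refine ⟨Units.map (algebraMap L (LocalRing L v) : L →* LocalRing L v) (Units.mk0 δ hδ0), ?_, ?_, ?_⟩
  · change conjLocal L (IsCMField.complexConj L) v (algebraMap L (LocalRing L v) δ) = -algebraMap L (LocalRing L v) δ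
    rw [conjLocal_algebraMap, hδc, map_neg]
  · rw [mem_localIntegers_iff]
    intro w
    have h := isIntegralMatrix_of_mem_glInt (hv w) 1 1
    simpa [coe_diagFrame, Matrix.diagonal_apply_eq] using h
  · rw [mem_localIntegers_iff]
    intro w
    have h := isIntegralMatrix_inv_of_mem_glInt (hv w)
    rw [← map_inv] at h
    have h11 : algebraMap L (w.1.adicCompletion L) ((((diagFrame (Units.mk0 δ hδ0))⁻¹ : GL (Fin 2) L) : Matrix (Fin 2) (Fin 2) L) 1 1) ∈
        𝒪[w.1.adicCompletion L] := h 1 1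
    rw [coe_diagFrame_inv, Matrix.diagonal_apply_eq] at h11
    simpa using h11

/-! ## §3 The scalar modulus identity `|t ⊗ 1|_{E_v} = |t|_v²` at a non-split unramified place -/

/-- **`Π_{w∣v} ‖t ⊗ 1‖_w = normAbs_{K_v}(t)²`** at a non-split place unramified in `L` (one place `w`, `e(w∣v) = 1`, `f(w∣v) = 2`: `‖t ⊗ 1‖_w = q_w^{−ord_v t} = (q_v²)^{−ord_v t}`).
[cite: NeukirchANT1999, Ch. II §6, §8] [cite: VignerasLNM800, Ch. II §1] -/
theorem localAbs_toLocalRing_of_nonsplit (w : PlacesOver L v) (hw : IsCMField.complexConj L • w.1 = w.1) (hunr : Algebra.IsUnramifiedIn (𝓞 L) v.asIdeal)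
    (t : v.adicCompletion ↥(maximalRealSubfield L)) :
    localAbs L v (toLocalRing L v t) = normAbs (v.adicCompletion ↥(maximalRealSubfield L)) t ^ 2 := by
  haveI : Algebra.IsQuadraticExtension ↥(maximalRealSubfield L) L := IsCMField.isQuadraticExtension L
  haveI : Subsingleton (PlacesOver L v) := PlacesOver.subsingleton_of_smul_eq (IsCMField.complexConj L) (IsCMField.complexConj_ne_one L) w hw
  rw [localAbs_apply, Fintype.prod_subsingleton _ w, toLocalRing_apply, nnnorm_eq_normAbs]
  by_cases ht : t = 0
  · rw [ht, map_zero, map_zero, map_zero, zero_pow two_ne_zero]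
  have hv0 : Valued.v t ≠ 0 := (Valuation.ne_zero_iff _).2 ht
  have htn : Valued.v t = WithZero.exp (Multiplicative.toAdd (WithZero.unzero hv0)) := by
    rw [WithZero.exp, ofAdd_toAdd, WithZero.coe_unzero]
  have htw : Valued.v (toPlace v w t) = WithZero.exp (Multiplicative.toAdd (WithZero.unzero hv0)) :=
    (Literature.NumberTheory.Automorphic.Liu2021.LemD1IndexedNonVacuityInertCofinite.valued_toPlace_of_isUnramifiedIn L v hunr w t).trans htn
  have key : ∀ (a : ℝ≥0) (m : ℤ), (a ^ 2)⁻¹ ^ m = (a⁻¹ ^ m) ^ 2 := by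
    intro a m
    rw [← inv_pow, ← zpow_natCast, ← zpow_natCast, ← zpow_mul, ← zpow_mul, mul_comm]
  rw [normAbs_eq_inv_zpow_of_valued_eq w.1 htw, normAbs_eq_inv_zpow_of_valued_eq v htn, residueFieldCard_adicCompletion_eq_absNorm,
    residueFieldCard_adicCompletion_eq_absNorm, Literature.NumberTheory.Rogawski1990.absNorm_placesOver_eq_sq_of_nonsplit_of_isUnramifiedIn L v w hw hunr,
    Nat.cast_pow]
  exact key _ _

/-! ## §4 Cofinite packaging of the frame data at non-split places -/

omit [IsCMField L] in
/-- All but finitely many places of `L⁺` are unramified in `L` (★ `finite_setOf_not_isUnramifiedIn`). [cite: NeukirchANT1999, Ch. III §2] -/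
theorem eventually_isUnramifiedIn : ∀ᶠ v : HeightOneSpectrum (𝓞 ↥(maximalRealSubfield L)) in Filter.cofinite, Algebra.IsUnramifiedIn (𝓞 L) v.asIdeal := by
  have h := (Literature.NumberTheory.GaloisRepresentations.finite_setOf_not_isUnramifiedIn ↥(maximalRealSubfield L) L).compl_mem_cofinite
  filter_upwards [h] with v hv
  simpa using hv

/-- **Frame data at almost every non-split place.**  For `h` hermitian with `det h ≠ 0`: for all but finitely many `v`, at every `w ∣ v` with `c w = w` there are an integral hyperbolic
frame `T` (`T, T⁻¹ ∈ M₂(𝒪_{E_v})`, `(T^σ)ᵀ Φ₂ T = H_v`), a skew unit `δ` (`σδ = −δ`, `δ, δ⁻¹ ∈ 𝒪_{E_v}`), and the scalar identity `|t ⊗ 1|_{E_v} = |t|_v²` — exactly the hypotheses of ★ C1b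
`exists_splittingDatum_of_frame`. [cite: Jacobowitz1962, §7 Thm. 7.1] [cite: PlatonovRapinchuk1994, §5.1] -/
theorem eventually_frameData_of_nonsplit (hHa : (Ha.map (cmConjRingHom L)).transpose = Ha) (hdet : Ha.det ≠ 0) :
    ∀ᶠ v : HeightOneSpectrum (𝓞 ↥(maximalRealSubfield L)) in Filter.cofinite, ∀ w : PlacesOver L v, IsCMField.complexConj L • w.1 = w.1 →
      (∃ (T : GL (Fin 2) (LocalRing L v)) (δ : (LocalRing L v)ˣ),
        ((T.val).map (conjLocal L (IsCMField.complexConj L) v))ᵀ * antidiagTwo (LocalRing L v) * T.val = localForm L 2 Ha v ∧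
        conjLocal L (IsCMField.complexConj L) v δ = -δ ∧ T.val ∈ intMatrices L 2 v ∧ T⁻¹.val ∈ intMatrices L 2 v ∧
        (δ : LocalRing L v) ∈ localIntegers L v ∧ ((δ⁻¹ : (LocalRing L v)ˣ) : LocalRing L v) ∈ localIntegers L v) ∧
      (∀ t : v.adicCompletion ↥(maximalRealSubfield L), localAbs L v (toLocalRing L v t) = normAbs (v.adicCompletion ↥(maximalRealSubfield L)) t ^ 2) := by
  have hHu : IsUnit Ha := (Matrix.isUnit_iff_isUnit_det Ha).2 (Ne.isUnit hdet)
  filter_upwards [eventually_isUnramifiedIn L, eventually_exists_skewUnit L,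
    eventually_forall_unit_placeForm_mem_glInt (F := ↥(maximalRealSubfield L)) 2 Ha hHu] with v hunr hδ hH w hw
  obtain ⟨δ, hδc, hδi, hδi'⟩ := hδ
  have hHi : (isUnit_placeForm Ha ((Matrix.isUnit_iff_isUnit_det Ha).2 (Ne.isUnit hdet)) w.1).unit ∈ glInt 2 (w.1.adicCompletion L) := by
    have h : (isUnit_placeForm Ha ((Matrix.isUnit_iff_isUnit_det Ha).2 (Ne.isUnit hdet)) w.1).unit = (isUnit_placeForm Ha hHu w.1).unit := Units.ext rfl
    rw [h]
    exact hH w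
  obtain ⟨T, hTi, hTi', hT⟩ := exists_integralFrame_of_nonsplit L Ha v hHa hdet w hw hunr hHi
  exact ⟨⟨T, δ, hT, hδc, hTi, hTi', hδi, hδi'⟩, localAbs_toLocalRing_of_nonsplit L v w hw hunr⟩

end Summit.HodgeConjecture.HodgeConjecture.Cruxes.H413.K2E5QuatLocalFrameSupply

end
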